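import Mathlib
import HarnessLib
import Literature.Analysis.FluidPDE.VorticityCalculus
import Summits.NavierStokesRegularity.NavierStokesRegularity.Theorems.LocalSineTubeDoorProfileAlignedWindowRigidityAncient
import Summits.NavierStokesRegularity.NavierStokesRegularity.Theorems.PoloidalWindowDoorPoloidalWindowRigidityLeafUniformVortexLine
import Summits.NavierStokesRegularity.NavierStokesRegularity.Theorems.PoloidalWindowDoorPoloidalWindowRigidityLeafUniformOrbits

/-!
# Route `PoloidalWindowDoor`, crux `PoloidalWindowRigidity` (stmt-NavierStokesRegularity-19708) — LINE 18 «leaf_uniform» v1.3 (ns-idea-8 g9): support R19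
# `LeafEnds`, VERBATIM (Cruxes-local `Pinned`, `hotSet`, `lapH`, `hess` unfolded)

Cell ns-regularity-ideate, seat ns-poloidal-K2-p2 g13 (K2 hand).  R19 (v1.3, «PROVABLE, M/L; support — topological dynamics of a complete hot leaf»): for a
complete vortex line `γ` of `ω(−1,·)` running inside the hot set with `ω ≠ 0` and the ridge law along it, given a closed hot set, no compact isolated hot piece
(R3) and local aloneness of regular hot points (R18's conclusion): (i) `γ` is injective; (ii) each end (`atTop`, `atBot`) escapes every compact set or clusters
at a hot NULL point `q` (`ω(q) = 0`, `Δₕv₂(q) = 0`).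

Proof = the docstring's, over the generic orbit lemmas of `…LeafUniformOrbits` (FILE A) for the bounded, globally Lipschitz field `ω(−1,·)`
(`…LeafUniformVortexLine.curl_slice_bounded_lipschitz`, p697506):
* `injective_of_alone` — a non-injective complete line is periodic with compact range `K ⊆ H`; the aloneness balls give an open `O ⊇ K` with `O ∩ H ⊆ K`
  (every captured hot point lies on a local arc through a point of `γ`, hence on `γ`), contradicting R3;
* `end_dichotomy` — for any end filter that eventually leaves every bounded time interval: not escaping ⇒ frequently in a compact set ⇒ a cluster point `q`
  (`IsCompact.exists_mapClusterPt_of_frequently`), `q ∈ closure (range γ) ⊆ H`; `ω(q) = 0`, for otherwise aloneness at `q` puts the returning points on the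
  single arc through `q`, i.e. (injectivity) in a bounded time window; `Δₕv₂(q) = 0` because the continuous ridge defect
  `Δₕv₂·‖ω(γ 0)‖² − Δₕv₂(γ 0)·‖ω‖²` vanishes on `range γ`, hence at `q`, where `ω(q) = 0 ≠ ω(γ 0)`.

HONEST LABEL: one M/L support of LINE 18; R8/R11/R16/R18 and the research cells are NOT touched; C2a′ / ⟨19708⟩ / ⟨20428⟩ OPEN; NS regularity NOT proved.
-/

noncomputable section

-- the summit and its single sub-problem share the name (CONVENTIONS §1), as in every Theorems file
set_option linter.dupNamespace false

namespace Summit.NavierStokesRegularity.NavierStokesRegularity.Theorems.PoloidalWindowDoorPoloidalWindowRigidityLeafUniformLeafEnds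

open Set Function Filter Topology Metric
open scoped InnerProductSpace RealInnerProductSpace Laplacian NNReal
open Literature.Analysis Literature.Analysis.FluidPDE Literature.Analysis.UnboundedOperators
open Summit.NavierStokesRegularity.NavierStokesRegularity.Theorems.LocalSineTubeDoorProfileAlignedWindowRigidityAncient
open Summit.NavierStokesRegularity.NavierStokesRegularity.Theorems.PoloidalWindowDoorPoloidalWindowRigidityLeafUniformVortexLine
open Summit.NavierStokesRegularity.NavierStokesRegularity.Theorems.PoloidalWindowDoorPoloidalWindowRigidityLeafUniformOrbits

/-! ## Abstract dynamics of a complete regular hot leaf -/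

section Abstract

variable {X : EuclideanSpace ℝ (Fin 3) → EuclideanSpace ℝ (Fin 3)} {K : ℝ≥0} {H : Set (EuclideanSpace ℝ (Fin 3))}
  {γ : ℝ → EuclideanSpace ℝ (Fin 3)}

/-- **(i) Injectivity**: a complete regular hot line is injective (no compact isolated hot piece + aloneness). -/
theorem injective_of_alone (hX : LipschitzWith K X)
    (hR3 : ∀ Kc O : Set (EuclideanSpace ℝ (Fin 3)), IsCompact Kc → Kc.Nonempty → Kc ⊆ H → IsOpen O → Kc ⊆ O → O ∩ H ⊆ Kc → False)
    (halone : ∀ y ∈ H, X y ≠ 0 → ∃ r : ℝ, 0 < r ∧ ∃ (α : ℝ → EuclideanSpace ℝ (Fin 3)) (δ : ℝ), 0 < δ ∧ α 0 = y ∧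
        (∀ s ∈ Set.Ioo (-δ) δ, HasDerivAt α (X (α s)) s) ∧ ∀ y' ∈ H, dist y' y < r → ∃ s ∈ Set.Ioo (-δ) δ, y' = α s)
    (hγ : ∀ τ, HasDerivAt γ (X (γ τ)) τ) (hγH : ∀ τ, γ τ ∈ H ∧ X (γ τ) ≠ 0) : Function.Injective γ := by
  by_contra hni
  have hKc : IsCompact (range γ) := isCompact_range_of_not_injective hX hγ hni
  choose r hr α δ hδ hα0 hα hcap using fun τ => halone (γ τ) (hγH τ).1 (hγH τ).2
  set O : Set (EuclideanSpace ℝ (Fin 3)) := ⋃ τ, ball (γ τ) (r τ) with hO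
  refine hR3 (range γ) O hKc ⟨γ 0, mem_range_self 0⟩ (fun p ⟨τ, hτ⟩ => hτ ▸ (hγH τ).1) (isOpen_iUnion fun τ => isOpen_ball)
    (fun p ⟨τ, hτ⟩ => mem_iUnion.2 ⟨τ, hτ ▸ mem_ball_self (hr τ)⟩) ?_
  rintro y' ⟨hyO, hyH⟩
  obtain ⟨τ, hτ⟩ := mem_iUnion.1 hyO
  obtain ⟨s, hs, hys⟩ := hcap τ y' hyH (mem_ball.1 hτ)
  rw [hys]
  exact localArc_mem_range hX hγ (hα τ) (s₀ := 0) (t := τ) ⟨by linarith [hδ τ], hδ τ⟩ (hα0 τ) hs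

/-- **(ii) End dichotomy** for an end filter `l` that eventually leaves every bounded time window: escape, or a hot null cluster point. -/
theorem end_dichotomy (hX : LipschitzWith K X) (hH : IsClosed H)
    (halone : ∀ y ∈ H, X y ≠ 0 → ∃ r : ℝ, 0 < r ∧ ∃ (α : ℝ → EuclideanSpace ℝ (Fin 3)) (δ : ℝ), 0 < δ ∧ α 0 = y ∧
        (∀ s ∈ Set.Ioo (-δ) δ, HasDerivAt α (X (α s)) s) ∧ ∀ y' ∈ H, dist y' y < r → ∃ s ∈ Set.Ioo (-δ) δ, y' = α s)
    {L : EuclideanSpace ℝ (Fin 3) → ℝ} (hL : Continuous L)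
    (hγ : ∀ τ, HasDerivAt γ (X (γ τ)) τ)
    (hγH : ∀ τ, γ τ ∈ H ∧ X (γ τ) ≠ 0 ∧ L (γ τ) * ‖X (γ 0)‖ ^ 2 = L (γ 0) * ‖X (γ τ)‖ ^ 2)
    (hinj : Function.Injective γ) (l : Filter ℝ) (hl : ∀ a b : ℝ, ∀ᶠ τ in l, τ ∉ Icc a b) :
    Tendsto γ l (cocompact (EuclideanSpace ℝ (Fin 3))) ∨
      ∃ q : EuclideanSpace ℝ (Fin 3), MapClusterPt q l γ ∧ q ∈ H ∧ X q = 0 ∧ L q = 0 := by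
  by_cases ht : Tendsto γ l (cocompact (EuclideanSpace ℝ (Fin 3)))
  · exact Or.inl ht
  right
  obtain ⟨s, hs, hfr⟩ := not_tendsto_iff_exists_frequently_notMem.1 ht
  obtain ⟨Kc, hKc, hKs⟩ := mem_cocompact.1 hs
  have hfrK : ∃ᶠ τ in l, γ τ ∈ Kc := hfr.mono fun τ hτ => by
    by_contra h
    exact hτ (hKs h)
  obtain ⟨q, -, hq⟩ := hKc.exists_mapClusterPt_of_frequently hfrK
  have hfreq : ∀ U ∈ 𝓝 q, ∃ᶠ τ in l, γ τ ∈ U := mapClusterPt_iff_frequently.1 hq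
  -- `q ∈ closure (range γ) ⊆ H`
  have hqcl : q ∈ closure (range γ) := by
    rw [mem_closure_iff_nhds]
    intro U hU
    obtain ⟨τ, hτ⟩ := (hfreq U hU).exists
    exact ⟨γ τ, hτ, mem_range_self τ⟩
  have hsub : range γ ⊆ H := by
    rintro _ ⟨τ, rfl⟩
    exact (hγH τ).1
  have hqH : q ∈ H := closure_minimal hsub hH hqcl
  -- `X q = 0`
  have hXq : X q = 0 := by
    by_contra hXq
    obtain ⟨r, hr, α, δ, hδ, hα0, hα, hcap⟩ := halone q hqH hXq
    have hball : ∃ᶠ τ in l, γ τ ∈ ball q r := hfreq _ (ball_mem_nhds q hr)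
    -- one return: `q = γ t⋆`
    obtain ⟨τ₁, hτ₁⟩ := hball.exists
    obtain ⟨s₁, hs₁, hys₁⟩ := hcap (γ τ₁) (hγH τ₁).1 (mem_ball.1 hτ₁)
    have hq1 : q = γ (τ₁ - s₁) := by rw [← hα0]; exact localArc_base_mem_range hX hγ hα hs₁ hys₁.symm
    -- a late return outside the time window `[t⋆ - δ, t⋆ + δ]`
    obtain ⟨τ, hτb, hτI⟩ := (hball.and_eventually (hl (τ₁ - s₁ - δ) (τ₁ - s₁ + δ))).exists
    obtain ⟨s, hs, hys⟩ := hcap (γ τ) (hγH τ).1 (mem_ball.1 hτb)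
    have hq2 : q = γ (τ - s) := by rw [← hα0]; exact localArc_base_mem_range hX hγ hα hs hys.symm
    have heq : τ - s = τ₁ - s₁ := hinj (hq2.symm.trans hq1)
    exact hτI ⟨by linarith [hs.1], by linarith [hs.2]⟩
  -- `L q = 0` from the ridge defect, continuous and vanishing on `range γ`
  have hc0 : ‖X (γ 0)‖ ^ 2 ≠ 0 := pow_ne_zero 2 (norm_ne_zero_iff.2 (hγH 0).2.1)
  have hΦ : L q * ‖X (γ 0)‖ ^ 2 - L (γ 0) * ‖X q‖ ^ 2 = 0 := by
    have hXc : Continuous X := hX.continuous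
    have hcl : IsClosed {p : EuclideanSpace ℝ (Fin 3) | L p * ‖X (γ 0)‖ ^ 2 - L (γ 0) * ‖X p‖ ^ 2 = 0} :=
      isClosed_eq ((hL.mul continuous_const).sub (continuous_const.mul ((continuous_norm.comp hXc).pow 2))) continuous_const
    have hsub' : range γ ⊆ {p : EuclideanSpace ℝ (Fin 3) | L p * ‖X (γ 0)‖ ^ 2 - L (γ 0) * ‖X p‖ ^ 2 = 0} := by
      rintro _ ⟨τ, rfl⟩
      exact sub_eq_zero.2 (hγH τ).2.2
    exact closure_minimal hsub' hcl hqcl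
  rw [hXq, norm_zero, zero_pow two_ne_zero, mul_zero, sub_zero] at hΦ
  exact ⟨q, hq, hqH, hXq, (mul_eq_zero.1 hΦ).resolve_right hc0⟩

end Abstract

/-! ## R19 -/

/-- **R19 `LeafEnds` (VERBATIM, `Pinned`/`hotSet`/`lapH`/`hess` unfolded).** -/
theorem leafEnds :
    ∀ (C : ℝ) (v : ℝ → EuclideanSpace ℝ (Fin 3) → EuclideanSpace ℝ (Fin 3)),
      (Literature.Analysis.FluidPDE.HasTypeITimeDecay C v ∧
        ContinuousOn (Function.uncurry v) (Set.Iio (0 : ℝ) ×ˢ Set.univ) ∧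
        (∀ s t : ℝ, s < t → t < 0 → ∀ x, v t x =
          Literature.Analysis.UnboundedOperators.heatExtension (v s) (t - s) x -
            Literature.Analysis.FluidPDE.oseenDuhamel 1 s v v t x) ∧
        (∀ t < 0, Literature.Analysis.FluidPDE.VectorCalculus.IsDivFree (v t)) ∧
        (∀ s < 0, ∀ y, ⟪Literature.Analysis.FluidPDE.curl (v s) y, EuclideanSpace.single 2 1⟫_ℝ = 0) ∧
        v (-1) 0 2 ≠ 0 ∧ (∀ t < 0, ∀ x, Real.sqrt (-t) * |v t x 2| ≤ |v (-1) 0 2|) ∧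
        (∀ h : EuclideanSpace ℝ (Fin 3), fderiv ℝ (v (-1)) 0 h 2 = 0) ∧
        (deriv (fun s => v s 0 2) (-1) = v (-1) 0 2 / 2 ∧ v (-1) 0 2 * (Δ (fun y => v (-1) y 2)) 0 ≤ 0)) →
      IsClosed {y : EuclideanSpace ℝ (Fin 3) | y 2 = 0 ∧ v (-1) y 2 = v (-1) 0 2} →
      (∀ K O : Set (EuclideanSpace ℝ (Fin 3)), IsCompact K → K.Nonempty → K ⊆ {y : EuclideanSpace ℝ (Fin 3) | y 2 = 0 ∧ v (-1) y 2 = v (-1) 0 2} →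
        IsOpen O → K ⊆ O → O ∩ {y : EuclideanSpace ℝ (Fin 3) | y 2 = 0 ∧ v (-1) y 2 = v (-1) 0 2} ⊆ K → False) →
      (∀ y ∈ {y : EuclideanSpace ℝ (Fin 3) | y 2 = 0 ∧ v (-1) y 2 = v (-1) 0 2}, Literature.Analysis.FluidPDE.curl (v (-1)) y ≠ 0 →
        ∃ r : ℝ, 0 < r ∧ ∃ (α : ℝ → EuclideanSpace ℝ (Fin 3)) (δ : ℝ), 0 < δ ∧ α 0 = y ∧
          (∀ s ∈ Set.Ioo (-δ) δ, HasDerivAt α (Literature.Analysis.FluidPDE.curl (v (-1)) (α s)) s) ∧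
          ∀ y' ∈ {y : EuclideanSpace ℝ (Fin 3) | y 2 = 0 ∧ v (-1) y 2 = v (-1) 0 2}, dist y' y < r → ∃ s ∈ Set.Ioo (-δ) δ, y' = α s) →
      ∀ γ : ℝ → EuclideanSpace ℝ (Fin 3), (∀ τ : ℝ, HasDerivAt γ (Literature.Analysis.FluidPDE.curl (v (-1)) (γ τ)) τ) →
        (∀ τ : ℝ, γ τ ∈ {y : EuclideanSpace ℝ (Fin 3) | y 2 = 0 ∧ v (-1) y 2 = v (-1) 0 2} ∧
          Literature.Analysis.FluidPDE.curl (v (-1)) (γ τ) ≠ 0 ∧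
          (fderiv ℝ (fun x => fderiv ℝ (fun x' => v (-1) x' 2) x (EuclideanSpace.single 0 1)) (γ τ) (EuclideanSpace.single 0 1) +
              fderiv ℝ (fun x => fderiv ℝ (fun x' => v (-1) x' 2) x (EuclideanSpace.single 1 1)) (γ τ) (EuclideanSpace.single 1 1)) *
            ‖Literature.Analysis.FluidPDE.curl (v (-1)) (γ 0)‖ ^ 2 =
          (fderiv ℝ (fun x => fderiv ℝ (fun x' => v (-1) x' 2) x (EuclideanSpace.single 0 1)) (γ 0) (EuclideanSpace.single 0 1) +
              fderiv ℝ (fun x => fderiv ℝ (fun x' => v (-1) x' 2) x (EuclideanSpace.single 1 1)) (γ 0) (EuclideanSpace.single 1 1)) *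
            ‖Literature.Analysis.FluidPDE.curl (v (-1)) (γ τ)‖ ^ 2) →
        Function.Injective γ ∧
        (Filter.Tendsto γ Filter.atTop (Filter.cocompact (EuclideanSpace ℝ (Fin 3))) ∨
          ∃ q : EuclideanSpace ℝ (Fin 3), MapClusterPt q Filter.atTop γ ∧ q ∈ {y : EuclideanSpace ℝ (Fin 3) | y 2 = 0 ∧ v (-1) y 2 = v (-1) 0 2} ∧
            Literature.Analysis.FluidPDE.curl (v (-1)) q = 0 ∧
            fderiv ℝ (fun x => fderiv ℝ (fun x' => v (-1) x' 2) x (EuclideanSpace.single 0 1)) q (EuclideanSpace.single 0 1) +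
              fderiv ℝ (fun x => fderiv ℝ (fun x' => v (-1) x' 2) x (EuclideanSpace.single 1 1)) q (EuclideanSpace.single 1 1) = 0) ∧
        (Filter.Tendsto γ Filter.atBot (Filter.cocompact (EuclideanSpace ℝ (Fin 3))) ∨
          ∃ q : EuclideanSpace ℝ (Fin 3), MapClusterPt q Filter.atBot γ ∧ q ∈ {y : EuclideanSpace ℝ (Fin 3) | y 2 = 0 ∧ v (-1) y 2 = v (-1) 0 2} ∧
            Literature.Analysis.FluidPDE.curl (v (-1)) q = 0 ∧
            fderiv ℝ (fun x => fderiv ℝ (fun x' => v (-1) x' 2) x (EuclideanSpace.single 0 1)) q (EuclideanSpace.single 0 1) +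
              fderiv ℝ (fun x => fderiv ℝ (fun x' => v (-1) x' 2) x (EuclideanSpace.single 1 1)) q (EuclideanSpace.single 1 1) = 0) := by
  intro C v hP hH hR3 halone γ hγ hγH
  obtain ⟨hrate, hcont, hmild, hdiv, -, -, -, -, -⟩ := hP
  obtain ⟨K, -, hK, -⟩ := curl_slice_bounded_lipschitz hrate hcont hmild hdiv (by norm_num : (-1 : ℝ) < 0)
  -- the horizontal Laplacian of the `C²` slice is continuous
  set f : EuclideanSpace ℝ (Fin 3) → ℝ := fun x => v (-1) x 2 with hf
  have hfa : ContDiff ℝ 2 f := by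
    have hsl := analyticOnNhd_slice hcont (bdd_of_hasTypeITimeDecay hrate) hmild (by norm_num : (-1 : ℝ) < 0)
    have han : AnalyticOnNhd ℝ f univ := fun x _ =>
      ((EuclideanSpace.proj (𝕜 := ℝ) (2 : Fin 3)).analyticAt _).comp (hsl x (mem_univ _))
    exact han.contDiff
  set L : EuclideanSpace ℝ (Fin 3) → ℝ := fun p =>
    fderiv ℝ (fun x => fderiv ℝ f x (EuclideanSpace.single 0 1)) p (EuclideanSpace.single 0 1) +
      fderiv ℝ (fun x => fderiv ℝ f x (EuclideanSpace.single 1 1)) p (EuclideanSpace.single 1 1) with hL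
  have hLc : Continuous L := by
    have hg : ∀ a : EuclideanSpace ℝ (Fin 3), ContDiff ℝ 1 (fun x => fderiv ℝ f x a) := fun a =>
      (hfa.fderiv_right (m := 1) (by norm_num)).clm_apply contDiff_const
    have hc : ∀ a : EuclideanSpace ℝ (Fin 3), Continuous fun p => fderiv ℝ (fun x => fderiv ℝ f x a) p a := fun a =>
      ((hg a).continuous_fderiv one_ne_zero).clm_apply continuous_const
    exact (hc _).add (hc _)
  have hγH' : ∀ τ, γ τ ∈ {y : EuclideanSpace ℝ (Fin 3) | y 2 = 0 ∧ v (-1) y 2 = v (-1) 0 2} ∧ curl (v (-1)) (γ τ) ≠ 0 ∧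
      L (γ τ) * ‖curl (v (-1)) (γ 0)‖ ^ 2 = L (γ 0) * ‖curl (v (-1)) (γ τ)‖ ^ 2 := fun τ => hγH τ
  have hinj : Function.Injective γ := injective_of_alone hK hR3 halone hγ fun τ => ⟨(hγH' τ).1, (hγH' τ).2.1⟩
  have htop := end_dichotomy hK hH halone hLc hγ hγH' hinj atTop fun a b =>
    (eventually_gt_atTop b).mono fun τ h hmem => absurd hmem.2 (not_le.2 h)
  have hbot := end_dichotomy hK hH halone hLc hγ hγH' hinj atBot fun a b =>
    (eventually_lt_atBot a).mono fun τ h hmem => absurd hmem.1 (not_le.2 h)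
  exact ⟨hinj, htop, hbot⟩

end Summit.NavierStokesRegularity.NavierStokesRegularity.Theorems.PoloidalWindowDoorPoloidalWindowRigidityLeafUniformLeafEnds

end
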